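import Literature.Topology.FourManifolds.GeneralPush
import Literature.Topology.FourManifolds.ArcTranslateGenericity
import HarnessLib

/-!
# Generic pushes produce transversal crossings and avoid countably many values

Topic `Literature/Topology/FourManifolds` (programme of the fact
`Literature.Topology.FourManifolds.exists_isSimplifiedBrokenLefschetzFibration`, Baykur–Saeki 2017, §2.1
p. 6, §3).  The step of the normal-crossing induction: in the general push `g_θ`
(`GeneralPush`) the image of a CORE arc `κ` (an arc in `V` along which `ρ ∘ ψ ∘ g = 1`) is
TRANSLATED by `θ` in the chart `ψ`, `ψ(g_θ(κ t)) = ψ(g(κ t)) + θ`, while a FAR arc `γ`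
(off `tsupport b`) is not moved.  By the Sard-type statements of `ArcTranslateGenericity`,
for almost every `θ`:

* wherever the pushed core arc meets the far arc, the two image curves cross transversally in
  the chart `ψ` (`GeneralPush.ae_pushed_cross_transverse`);
* the pushed core arc avoids any countable set of points of `B` (`GeneralPush.ae_pushed_ne`).

Everything is proved; no definitions, no named facts (D-0026).

## References

* R. İ. Baykur, O. Saeki, *Simplifying indefinite fibrations on 4-manifolds*, arXiv:1705.11169,
  §2.1 p. 6, §3. [BaykurSaeki2017]
* M. W. Hirsch, *Differential Topology*, GTM 33 (1976), Ch. 3 §2, Thm. 2.7. [HirschDT1976]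
-/

noncomputable section

set_option maxSynthPendingDepth 2

open MeasureTheory Set Function Filter Module Metric
open scoped ContDiff Topology Manifold

namespace Literature.Topology.FourManifolds

/-- Local notation: `𝔼 n` is the model Euclidean space `EuclideanSpace ℝ (Fin n)`. -/
local notation "𝔼 " n:arg => EuclideanSpace ℝ (Fin n)

namespace GeneralPush

variable {X : Type*} [TopologicalSpace X] [ChartedSpace (𝔼 4) X]
  {B : Type*} [TopologicalSpace B] [ChartedSpace (𝔼 2) B]
  {g : X → B} {ψ : OpenPartialHomeomorph B (𝔼 2)} {b : X → ℝ} {ρ : 𝔼 2 → ℝ} {V : Set X}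
  {δ : ℝ}

/-- The chart curve of `g` along a smooth arc is `C^∞` where the arc maps into `ψ.source`.
[folklore] -/
theorem contDiffOn_chart_arc (hg : ContMDiff (𝓡 4) (𝓡 2) ∞ g)
    (hψ : ContMDiffOn (𝓡 2) (𝓡 2) ∞ ψ ψ.source) {γ : ℝ → X} {I : Set ℝ}
    (hγ : ContMDiffOn 𝓘(ℝ, ℝ) (𝓡 4) ∞ γ I) (hI : ∀ u ∈ I, g (γ u) ∈ ψ.source) :
    ContDiffOn ℝ ∞ (fun u => ψ (g (γ u))) I :=
  contMDiffOn_iff_contDiffOn.1 (hψ.comp (hg.comp_contMDiffOn hγ) hI)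

omit [TopologicalSpace X] [ChartedSpace (𝔼 4) X] [ChartedSpace (𝔼 2) B] in
/-- On a core arc, `ψ (g_θ (κ t)) = ψ (g (κ t)) + θ`. [folklore] -/
theorem apply_pushed_core (hVs : V ⊆ g ⁻¹' ψ.source) (hVb : ∀ q ∈ V, b q = ρ (ψ (g q)))
    {θ : 𝔼 2} (hθt : ∀ q, g q ∈ ψ.source → ψ (g q) + b q • θ ∈ ψ.target)
    {κ : ℝ → X} {t : ℝ} (hκV : κ t ∈ V) (hκ1 : ρ (ψ (g (κ t))) = 1) :
    ψ (pushed g ψ b θ (κ t)) = ψ (g (κ t)) + θ := by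
  rw [(apply_pushed hθt (hVs hκV)).2, hVb _ hκV, hκ1, one_smul]

/-- **Generic pushes cross far arcs transversally.**  Let `κ` be a core arc (`κ(J) ⊆ V`,
`ρ ∘ ψ ∘ g ∘ κ = 1` on the open set `J`) and `γ` a smooth arc on the open set `I`.  For almost
every `θ` (any additive Haar measure on `ℝ²`) within the margin `δ`: whenever
`g_θ(κ t) = g_θ(γ u)` with `t ∈ J`, `u ∈ I`, `γ u ∉ tsupport b`, the velocities of the two
image curves in the chart `ψ` span `ℝ²`. [cite: BaykurSaeki2017, §2.1, p. 6]
[cite: HirschDT1976, Ch. 3 §2, Thm. 2.7] -/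
theorem ae_pushed_cross_transverse (μ : Measure (𝔼 2)) [μ.IsAddHaarMeasure]
    (hg : ContMDiff (𝓡 4) (𝓡 2) ∞ g) (hψ : ContMDiffOn (𝓡 2) (𝓡 2) ∞ ψ ψ.source)
    (hVs : V ⊆ g ⁻¹' ψ.source) (hVb : ∀ q ∈ V, b q = ρ (ψ (g q)))
    (hδ : ∀ θ : 𝔼 2, ‖θ‖ < δ → ∀ q, g q ∈ ψ.source → ψ (g q) + b q • θ ∈ ψ.target)
    {κ : ℝ → X} {J : Set ℝ} (hJ : IsOpen J) (hκ : ContMDiffOn 𝓘(ℝ, ℝ) (𝓡 4) ∞ κ J)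
    (hκV : ∀ t ∈ J, κ t ∈ V) (hκ1 : ∀ t ∈ J, ρ (ψ (g (κ t))) = 1)
    {γ : ℝ → X} {I : Set ℝ} (hI : IsOpen I) (hγ : ContMDiffOn 𝓘(ℝ, ℝ) (𝓡 4) ∞ γ I) :
    ∀ᵐ θ ∂μ, ‖θ‖ < δ → ∀ t ∈ J, ∀ u ∈ I, γ u ∉ tsupport b →
      pushed g ψ b θ (κ t) = pushed g ψ b θ (γ u) →
      ∀ v : 𝔼 2, ∃ a c : ℝ,
        a • deriv (fun t => ψ (pushed g ψ b θ (κ t))) t +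
          c • deriv (fun u => ψ (pushed g ψ b θ (γ u))) u = v := by
  -- the two chart curves
  set c₁ : ℝ → 𝔼 2 := fun t => ψ (g (κ t)) with hc₁
  set U₂ : Set ℝ := I ∩ γ ⁻¹' ((tsupport b)ᶜ ∩ g ⁻¹' ψ.source) with hU₂
  set c₂ : ℝ → 𝔼 2 := fun u => ψ (g (γ u)) with hc₂
  have hγc : ContinuousOn γ I := hγ.continuousOn
  have hU₂o : IsOpen U₂ :=
    hγc.isOpen_inter_preimage hI
      ((isClosed_tsupport b).isOpen_compl.inter (ψ.open_source.preimage hg.continuous))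
  have hc₁s : ContDiffOn ℝ ∞ c₁ J := contDiffOn_chart_arc hg hψ hκ fun t ht => hVs (hκV t ht)
  have hc₂s : ContDiffOn ℝ ∞ c₂ U₂ :=
    contDiffOn_chart_arc hg hψ (hγ.mono inter_subset_left) fun u hu => hu.2.2
  filter_upwards [ae_translate_cross_transverse μ hJ hU₂o hc₁s hc₂s] with θ hθ hθδ t ht u hu
    hub heq v
  have hθt := hδ θ hθδ
  -- `g (γ u) ∈ ψ.source`, from the crossing
  have hPγ : pushed g ψ b θ (γ u) = g (γ u) := pushed_eq_of_notMem_tsupport hub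
  have hgu : g (γ u) ∈ ψ.source := by
    rw [← hPγ, ← heq]
    exact (apply_pushed hθt (hVs (hκV t ht))).1
  have hu₂ : u ∈ U₂ := ⟨hu, hub, hgu⟩
  -- the chart identity at the crossing
  have hval : c₁ t + θ = c₂ u := by
    simp only [hc₁, hc₂]
    rw [← apply_pushed_core hVs hVb hθt (hκV t ht) (hκ1 t ht), heq, hPγ]
  obtain ⟨a, c, hac⟩ := hθ t ht u hu₂ hval v
  -- the derivatives of the pushed chart curves are those of `c₁`, `c₂`
  have hd1 : deriv (fun t => ψ (pushed g ψ b θ (κ t))) t = deriv c₁ t := by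
    have hev : (fun t => ψ (pushed g ψ b θ (κ t))) =ᶠ[𝓝 t] fun t => c₁ t + θ :=
      eventually_of_mem (hJ.mem_nhds ht) fun t' ht' =>
        apply_pushed_core hVs hVb hθt (hκV t' ht') (hκ1 t' ht')
    rw [hev.deriv_eq, deriv_add_const]
  have hd2 : deriv (fun u => ψ (pushed g ψ b θ (γ u))) u = deriv c₂ u := by
    have hev : (fun u => ψ (pushed g ψ b θ (γ u))) =ᶠ[𝓝 u] c₂ := by
      have hn : ∀ᶠ u' in 𝓝 u, γ u' ∉ tsupport b := by
        have h1 : U₂ ∈ 𝓝 u := hU₂o.mem_nhds hu₂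
        filter_upwards [h1] with u' hu'
        exact hu'.2.1
      filter_upwards [hn] with u' hu'
      simp only [hc₂, pushed_eq_of_notMem_tsupport hu']
    rw [hev.deriv_eq]
  exact ⟨a, c, by rw [hd1, hd2]; exact hac⟩

/-- **Generic pushes avoid countably many points.**  For almost every `θ` within the margin,
the pushed core arc misses every point of a countable set `W ⊆ B`.
[cite: BaykurSaeki2017, §2.1, p. 6] [cite: HirschDT1976, Ch. 3 §2, Thm. 2.7] -/
theorem ae_pushed_ne (μ : Measure (𝔼 2)) [μ.IsAddHaarMeasure]
    (hg : ContMDiff (𝓡 4) (𝓡 2) ∞ g) (hψ : ContMDiffOn (𝓡 2) (𝓡 2) ∞ ψ ψ.source)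
    (hVs : V ⊆ g ⁻¹' ψ.source) (hVb : ∀ q ∈ V, b q = ρ (ψ (g q)))
    (hδ : ∀ θ : 𝔼 2, ‖θ‖ < δ → ∀ q, g q ∈ ψ.source → ψ (g q) + b q • θ ∈ ψ.target)
    {κ : ℝ → X} {J : Set ℝ} (hJ : IsOpen J) (hκ : ContMDiffOn 𝓘(ℝ, ℝ) (𝓡 4) ∞ κ J)
    (hκV : ∀ t ∈ J, κ t ∈ V) (hκ1 : ∀ t ∈ J, ρ (ψ (g (κ t))) = 1)
    {W : Set B} (hW : W.Countable) :
    ∀ᵐ θ ∂μ, ‖θ‖ < δ → ∀ t ∈ J, ∀ w ∈ W, pushed g ψ b θ (κ t) ≠ w := by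
  set c₁ : ℝ → 𝔼 2 := fun t => ψ (g (κ t)) with hc₁
  have hc₁s : ContDiffOn ℝ ∞ c₁ J := contDiffOn_chart_arc hg hψ hκ fun t ht => hVs (hκV t ht)
  have hall : ∀ᵐ θ ∂μ, ∀ w ∈ W, ∀ s ∈ J, c₁ s + θ ≠ ψ w :=
    (ae_ball_iff hW).2 fun w _ => ae_translate_ne μ hJ hc₁s (ψ w)
  filter_upwards [hall] with θ hθ hθδ t ht w hw heq
  have hθt := hδ θ hθδ
  have hmem : pushed g ψ b θ (κ t) ∈ ψ.source := (apply_pushed hθt (hVs (hκV t ht))).1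
  apply hθ w hw t ht
  rw [← apply_pushed_core hVs hVb hθt (hκV t ht) (hκ1 t ht), heq]

end GeneralPush

end Literature.Topology.FourManifolds
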